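import Summits.BirchSwinnertonDyer.BirchSwinnertonDyer.Theses.BiquadraticEisensteinDescent
import Summits.BirchSwinnertonDyer.BirchSwinnertonDyer.Theorems.EdixhovenFibreFiveSevenStarredOptimalManinUnitFiveSevenCdtThm1
import Literature.NumberTheory.EllipticCurves.ComplexMultiplicationNotSemistable
import HarnessLib

/-!
# Route `BiquadraticEisensteinDescent`: the residual R₅₇ `ManinDatumFiveSevenCMInert` (stmt-BirchSwinnertonDyer-20242), closed by name

Cell `pub/bsd-wall`, seat `bsd-line-edix-p4` g41 (cross-route closer; no seat holds the item, unclaimed at filing).  ONE theorem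
(no definition, no named fact, no instance, no `sorry`).

R₅₇: for a CM curve `W/ℚ` (globally minimal) of analytic rank `1`, `p ∈ {5, 7}` inert in the CM field and bad for `W`, and a
lattice-optimal conductor-level datum `D` (`Λ_W = c · Λ_f`): `p ∤ c(D)`.  CM + bad ⟹ additive at `p`
(`Rank1Residual.not_mult_of_hasCM`, [SilvermanATAEC1994, Thm. II.6.4]); then `p ∤ c` at a lattice-optimal datum of a curve additive
at `p ≥ 5` — `EdixhovenFibreFiveSevenOfCDTInt.not_dvd_c_of_CDTInt` (p811415: `p² ∣ N`, then `|c| = 1` at a level with an odd square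
factor by the integer `c`-division chain) applied to the tree theorem `calegariDimitrovTang2025_unboundedDenominators_holds`
(p826028; line `cdt_thm1` of crux K★ of route EdixhovenFibreFiveSeven).  This is the proof of the landed conditional closer
`BiquadraticEisensteinDescentOfCDT.maninDatumFiveSevenCMInert_of_CDT` (ttd-p1 g31, keyed on the Remark-58/59 reading) with the
Manin step re-keyed on Theorem 1.0.1 and that key DISCHARGED; the file imports the route file directly and nothing else of its cone.

HONEST STATUS.  No W-ALL class theorem is proved: the rung `WAllCornerFInertBad` still needs the route's other `closes` hypotheses
(`InertBadAtThree`, the Eisenstein-divisibility / Heegner-supply / Katz–Waldspurger items and the published-input bundles).  BSD is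
NOT proved by this; Manin's conjecture is not announced. [cite: CalegariDimitrovTang2025, Thm. 1.0.1]
[cite: SilvermanATAEC1994, Thm. II.6.4] [cite: LingOesterle1991, Thm. 6]
-/

set_option autoImplicit false
-- the Theorems namespace of a single-conjunct summit repeats the summit name by design (D-0017)
set_option linter.dupNamespace false

noncomputable section

open scoped Classical

open WeierstrassCurve Literature.NumberTheory.EllipticCurves Literature.NumberTheory.EllipticCurves.ModularForms
  Literature.NumberTheory.EllipticCurves.Rank1Residual
  Summit.BirchSwinnertonDyer.BirchSwinnertonDyer.Theses.BiquadraticEisensteinDescent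
  Summit.BirchSwinnertonDyer.BirchSwinnertonDyer.Theorems

namespace Summit.BirchSwinnertonDyer.BirchSwinnertonDyer.Theorems.BiquadraticEisensteinDescentCdtThm1

/-- **Crux R₅₇ `ManinDatumFiveSevenCMInert` (stmt-BirchSwinnertonDyer-20242), proved by name**: a CM curve of analytic rank `1`,
`p ∈ {5, 7}` inert and bad, lattice-optimal conductor-level datum ⟹ `p ∤ c` — CM + bad ⟹ additive (`not_mult_of_hasCM`), then
`EdixhovenFibreFiveSevenOfCDTInt.not_dvd_c_of_CDTInt` over the tree theorem `calegariDimitrovTang2025_unboundedDenominators_holds`;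
the rank and inertness clauses are idle.  BSD is NOT proved by this. [cite: CalegariDimitrovTang2025, Thm. 1.0.1]
[cite: SilvermanATAEC1994, Thm. II.6.4] -/
theorem ManinDatumFiveSevenCMInert_proof : ManinDatumFiveSevenCMInert := by
  intro W _ _ _ p _ D hCM _hr h57 _hin hbad hlat
  have hp5 : 5 ≤ p := by rcases h57 with rfl | rfl <;> omega
  have hadd : Addv W p := ⟨hbad, not_mult_of_hasCM W hCM p⟩
  exact EdixhovenFibreFiveSevenOfCDTInt.not_dvd_c_of_CDTInt calegariDimitrovTang2025_unboundedDenominators_holds D hp5 hadd hlat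

end Summit.BirchSwinnertonDyer.BirchSwinnertonDyer.Theorems.BiquadraticEisensteinDescentCdtThm1

end
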